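import Summits.QuantumFields.YangMills.Theorems.BalabanUVNodesN15TwoSpacingGluingNeumannKnitRightDefect
import Summits.QuantumFields.YangMills.Theorems.BalabanUVNodesN15TwoSpacingGluingNeumannKnitNodeRight
import HarnessLib

/-!
# THE GLUING STEP AT TWO LATTICE SPACINGS, LIX: `NE2PlusOperator` BY NAME FOR THE COVER's GLUED `U ≡ 1` PAIR, `(gf i).M := L^m` LIVE, NO DISPLAYED ROW (dag-n15-c g14, FILE 101;
# N15 = NE2, s1 «background-layer OPERATOR ingredient»)

Cell `pub-ymgap`, seat `pub-ymgap-dag-n15-c` (R134 (a); HUMAN RULING D-0062), generation 14.  `bears_on: R4∕N15 · K3⁸ SpineGivenEndpointR13SepCoPHV (stmt-QuantumFields-27366)`.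
Filed `--supports stmt-QuantumFields-27366 --as helper` — COUNT-NEUTRAL.  Theorems only (0 `def`, 0 `sorry`).  Imports BY NAME FILE 98 `…NeumannKnitRightDefect` (★★★ `hasMaj_idef_remainderL_knit`, hypothesis-free:
the two-grid defect of the cover's adjoint remainder) and FILE 96 `…NeumannKnitNodeRight` (★★★ `ne2PlusOperator_knit_of_rightDefect`: FILE 50's socket called through FILE 93 `ne2PlusOperator_knit_of_rightRows` and
FILE 95 `hasMaj_remainderL_knit_pair`, modulo exactly that defect); nothing in the tree is modified.

WHY ∕ WHAT.  The composition the lineage g11–g14 was built for.  FILE 50 `ne2PlusOperator_glued_of_letters` turns fourteen rows (`GluedLetters`) about cube-localized propagators at two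
spacings, a quadratic partition and the gluing remainders into `NE2PlusOperator` BY NAME for the glued operator `G = G₀(1 − R)⁻¹`, with the `M ≥ M₁` guard of [B9] Thm 3.1 LIVE as the
convergence of the expansion.  FILES 66–97 and dag-n15-a's programme N typed the fourteen rows for the Neumann-cube cover of the doubled torus `MP (paramsOf d L (m+1) k hL)` at `U ≡ 1`
(`knitInstance_gf_M : (gf i).M = L^m`); FILE 96 left ONE row displayed, `𝔇(R̃′, R̃)`; FILE 98 proves it (FILE 97's local part, FILE 100's nonlocal part via FILE 99's operator letter of
Bałaban's `Q*Q` on rough inputs, dag-n15-a N-IIq∕N-IIr for the forward right entry).  ★★★ **`ne2PlusOperator_knit (hd1 : 1 ≤ d) (hL : Odd L ∧ 1 < L) (ha : 0 < a) (c35 θc θ : ℝ) :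
NE2PlusOperator c35 (knitInstance hL θc θ) (knitFamily hL a θc θ)`** — no displayed hypothesis; `_dim4` the four-dimensional instance.

HONEST FRAMING ∕ LIMITS.  This is `T4EtaRate.NE2PlusOperator` BY NAME for ONE realised family: Bałaban's `U ≡ 1` Landau-gauge operator `Δ_a` on the doubled-cube tori, glued from
Neumann-by-images cube propagators with the (2.36)-type partition — a MODEL of [B6] §2's construction at two spacings (cube = half torus: circular as an estimate of anything infinite-volume);
the (3.35) regularity window of the instance is consumed vacuously (the entries do not depend on the background `U`) — this is NOT [B9]'s background-dependent pair `G(U), G(U′)`; the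
constants are crude and ours; nothing of [B5]∕[B6] (2.38)–(2.40)∕[B9] Thm 3.1, 3.14 is asserted ([B9] Thm 3.14 = difference TEMPLATE).  NE2⁺ as printed is NOT PRINTED here and NOT proved;
N15 is NOT discharged; counts of record UNMOVED (typed 28∕28 · discharged 5∕27); one finite 𝕋⁴ at fixed ε per index — NOT infinite volume, NOT OS on ℝ⁴, NOT a mass gap, NOT Clay; R4 closes
`BalabanLadder.UV` only.  Restate-immune (no Theses import).
v1.1 (append-only): §Zero `ne2ZeroOperator_knit` (+`_dim4`) — the node's fourth decl `NE2ZeroOperator` for the same family via `T4EtaRate.ne2Zero_of_ne2Plus`.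
-/

noncomputable section

namespace Summit.QuantumFields.YangMills.BalabanUVNodes.N15.Gluing

open Literature.MathematicalPhysics.QuantumFieldTheory.Balaban1983to89.T4EtaRate (NE2PlusOperator)

variable {d : ℕ} {L : ℕ} [NeZero L]

/-- ★★★ **NE2⁺, OPERATOR LAYER, BY NAME, FOR THE COVER's GLUED `U ≡ 1` PAIR — `(gf i).M := L^m` LIVE, NO DISPLAYED ROW.**  For `d ≥ 1`, odd `L ≥ 3`, `a > 0` and any `c₃₅, θc, θ`:
`NE2PlusOperator c₃₅ (knitInstance hL θc θ) (knitFamily hL a θc θ)` — FILE 96 `ne2PlusOperator_knit_of_rightDefect` fed with FILE 98 `hasMaj_idef_remainderL_knit` (its `M₅ ≤ L^m` premise unused: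
the defect row holds for every `m`). [cite: Balaban1985BackgroundPropagators, Thm 3.1 p.397 (quantifier template «M ≥ M₁ … Mα₀ ≤ a₀»), Thm 3.14 pp.426–427 (difference template); Balaban1984PropagatorsII,
Prop. 2.6 (2.135)–(2.136) p.247 (mechanism), (2.91)–(2.93) p.239; King1986, Prop. 3.9 (3.73) p.665 (rate factor)] -/
theorem ne2PlusOperator_knit (hd1 : 1 ≤ d) (hL : Odd L ∧ 1 < L) {a : ℝ} (ha : 0 < a) (c35 θc θ : ℝ) :
    NE2PlusOperator c35 (knitInstance (d := d) hL θc θ) (knitFamily (d := d) hL a θc θ) := by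
  obtain ⟨δ, rr, γ, hδ, hrr, hγ, H⟩ := hasMaj_idef_remainderL_knit (d := d) hL ha
  exact ne2PlusOperator_knit_of_rightDefect (d := d) hd1 hL ha c35 θc θ (M₅ := 0) ⟨δ, rr, γ, hδ, hrr, hγ, fun m kk r hk hn4 _ => H m kk r hk hn4⟩

/-- The four-dimensional instance (`d + 1 = 4`): `NE2PlusOperator c₃₅ (knitInstance hL θc θ) (knitFamily hL a θc θ)` on the doubled-cube tori of `𝕋⁴`-type, no displayed row.
[cite: Balaban1985BackgroundPropagators, Thm 3.1 p.397 (quantifier template)] -/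
theorem ne2PlusOperator_knit_dim4 (hL : Odd L ∧ 1 < L) {a : ℝ} (ha : 0 < a) (c35 θc θ : ℝ) :
    NE2PlusOperator c35 (knitInstance (d := 3) hL θc θ) (knitFamily (d := 3) hL a θc θ) :=
  ne2PlusOperator_knit (d := 3) (by norm_num) hL ha c35 θc θ

section Zero

open Literature.MathematicalPhysics.QuantumFieldTheory.Balaban1983to89.T4EtaRate (NE2ZeroOperator ne2Zero_of_ne2Plus)

/-- ★★ **NE2⁰ FOR THE SAME FAMILY — the node's fourth decl `T4EtaRate.NE2ZeroOperator` BY NAME** (v1.1): at the fine carrier's trivial configuration (`coeffBg.one = 0`; (3.35) holds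
there for every `α₀ > 0` since `M = L^m > 0` and `θ ≥ 0`) the glued family obeys `EtaRateIneq342` with the size guard `M₅ ≤ L^m` live — `T4EtaRate.ne2Zero_of_ne2Plus` at `c₃₅ = 1`.
[cite: King1986, Props. 3.8–3.9 (3.71)–(3.75) pp.664–665 (A = 0 model); Balaban1985BackgroundPropagators, Thm 3.1 p.397 (quantifier template)] -/
theorem ne2ZeroOperator_knit (hd1 : 1 ≤ d) (hL : Odd L ∧ 1 < L) {a : ℝ} (ha : 0 < a) (θc θ : ℝ) (hθ : 0 ≤ θ) :
    NE2ZeroOperator (knitInstance (d := d) hL θc θ) (knitFamily (d := d) hL a θc θ) := by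
  refine ne2Zero_of_ne2Plus (c35 := 1) (fun i α₀ hα₀ => ?_) (ne2PlusOperator_knit (d := d) hd1 hL ha 1 θc θ)
  have hL0 : (0 : ℝ) < L := by exact_mod_cast (show 0 < L by have := hL.2; omega)
  have hM : 0 ≤ (1 : ℝ) * (L : ℝ) ^ i.m * α₀ := by positivity
  refine ⟨fun x' => ?_, fun x₁ x₂ _ => ?_⟩
  · show |(0 : ℝ)| ≤ 1 * (L : ℝ) ^ i.m * α₀
    rw [abs_zero]
    exact hM
  · show |(0 : ℝ) - 0| ≤ 1 * (L : ℝ) ^ i.m * α₀ * θ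
    rw [sub_zero, abs_zero]
    exact mul_nonneg hM hθ

/-- The four-dimensional instance of the NE2⁰ corollary (v1.1). [cite: King1986, Props. 3.8–3.9 (3.71)–(3.75) pp.664–665 (A = 0 model)] -/
theorem ne2ZeroOperator_knit_dim4 (hL : Odd L ∧ 1 < L) {a : ℝ} (ha : 0 < a) (θc θ : ℝ) (hθ : 0 ≤ θ) :
    NE2ZeroOperator (knitInstance (d := 3) hL θc θ) (knitFamily (d := 3) hL a θc θ) :=
  ne2ZeroOperator_knit (d := 3) (by norm_num) hL ha θc θ hθ

end Zero

end Summit.QuantumFields.YangMills.BalabanUVNodes.N15.Gluing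

end
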